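/-
Copyright (c) 2026 the pub-hodgecm-mathlib formalisation cell (harness21).  Prover seat hodgecm-mathlib-B-p14 (g37), 2026-09-01.  Road «S3-tree» (architect A-p16 (g30) A-128 «swap»),
brick T3′ «depth-zero κ-transfer», population (P-2) TYPE (2), row (R2²) «THE FREE ROW», organ [T2-b] «THE GOOD CLASS HAS `κ = (−1)^n`» — THE CORE HEAD over ★ O8a-∃ and the ★ kernel
`SymmetricEigenframeParity`: a RATIONAL good vector exists iff `v_w(d₀) ≡ n (mod 2)` (R2² holder A-p19 (g26), plan 19:17:00Z ¶ [T2-b]; [T2-a] F0P3b-p01 (g12)).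
-/
import Literature.NumberTheory.Automorphic.SplitTorusOrderNormCriterion   -- ★ O8a-∃ p845516 A-p19 (g25): `exists_criterion_of_norm_solutions`, `isUnit_normSymm_of_criterion`, `symmProd_fixed` (generic field + subring)
import Literature.NumberTheory.Automorphic.SymmetricEigenframeParity      -- ★ [T2-b] kernel p846537 (this seat): `even_and_even_iff_of_odd_add`
import HarnessLib

/-!
# The good type-(2) class: a RATIONAL good vector for the symmetric eigenframe exists iff `½·log|d₀| + n` is even (Rogawski 1990 Lemma 4.9.3; Jacobowitz 1962 §5, §7)

Topic `NumberTheory/Automorphic`; namespace `Literature.NumberTheory.Automorphic.SymmetricEigenframe`.  THEOREMS ONLY (no definition, no instance, no notation, no named fact, no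
`sorry`); generic: ONE field `K` with `[Valued K ℤᵐ⁰]`, a subring `O`, and TWO ring endomorphisms `σ`, `ι`.  Cell `pub/hodgecm-mathlib` (D-0151), crux H413 =
`stmt-HodgeConjecture-24833`; road «S3-tree», brick T3′ «depth-zero κ-transfer», P-2 row (R2²) «THE FREE ROW, TYPE (2)» (holder A-p19 (g26); architect A-p16 (g30) A-127∕A-128),
organ **[T2-b] «THE GOOD CLASS HAS `κ = (−1)^n`»**, CORE HEAD.  HONEST LABEL: HC_CM is proved only modulo the 2 remaining named inputs (hLiu418 24832, h413 24833) until rung 0 closes;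
elementary valuation algebra over ★ O8a-∃, asserts nothing printed.

THE DICTIONARY (A-p19 (g26) 19:17:00Z ¶ [T2-b]; no carrier appears here).  `K` = the ramified quadratic eigen-field `K₁ = L_w(√disc χ_g)` of a type-(2) class, with its valuation;
`σ` = `σ̃ = σ_w ⊗ 1` (the CM involution; `K ∕ K^σ` UNRAMIFIED), `ι` = `ι′` (the `L_w`-involution; `K ∕ K^ι = K ∕ L_w` RAMIFIED, so `L_w = Fix ι` and `log|·|_K = 2·log|·|_w` on it);
`O = 𝒪_K`; `γ = (u, λ, ι′λ)` the eigenvalues (norm one, residually `1 + γᵢ` units, `γ₀` rational, `γ₂ = ιγ₁`); `d = (d₀, d₁, ι′d₁)` the diagonal Gram values of the symmetric eigenframe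
`P = [x₀ | x₁ | ι′x₁]` (`σ`-fixed); `δ` a skew unit of `L_w` (`σδ = −δ`, `ιδ = δ`); exponents `log|γ₀ − γ₁| = −n` (`|χ_g(u)|_w = q^{−n}`), `log|γ₁ − γ₂| = −(2N+1)`
(`|disc χ_g|_w = q^{−(2N+1)}`); the frame parity `Odd(½·log|d₀| + log|d₁|)` is ★ kernel `odd_half_log_add_log_of_symmetric_frame`.  A vector `a ∈ K³` is RATIONAL if `ι a₀ = a₀`,
`a₂ = ι a₁` (eigen-coordinates of a vector of `L_w³`), and GOOD in ★ O8a-1∕O8a-3∕O8a-∃'s token: `T(a) := (dᵢ·aᵢσ(aᵢ)·∏_{j≠i}(γᵢ − γⱼ))ᵢ ∈ span_O{γ^j}` with unit components.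
NORM DICTIONARIES (hypotheses, discharged by the carrier): (nK) a `σ`-fixed `c ≠ 0` of EVEN `log|c|` is an inverse norm `aσ(a)c = 1` (`K ∕ K^σ` unramified); (nE) a `σ`- and
`ι`-fixed `c ≠ 0` with `4 ∣ log|c|` has a RATIONAL solution `ιa = a`, `aσ(a)c = 1` (`L_w ∕ L⁺_v` inert, read inside `K`); and (rE) `ι`-fixed non-zero elements have even `log|·|`.

THE RESULT.  §1 the symmetrised criterion scalars `c̃ᵢ := dᵢ·∏_{j≠i}(γᵢ − γⱼ)∕((1+γᵢ)(1+γⱼ)δ)` of ★ O8a-∃ have `log|c̃₀| = log|d₀| − 2n`, `log|c̃₁| = log|d₁| − n − (2N+1)`, `c̃₂ = ι c̃₁`,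
`ι c̃₀ = c̃₀`.  §2 (⟸) if `½·log|d₀| + n` is even then `4 ∣ log|c̃₀|` and (by the frame parity) `log|c̃₁|` is even, so (nE), (nK) give `a₀` rational and `a₁` with `aᵢσ(aᵢ)c̃ᵢ = 1`,
`a₂ := ιa₁` solves the third equation, and ★ `exists_criterion_of_norm_solutions` makes `a` GOOD.  §3 (⟹) a rational good `a` makes `a₀σ(a₀)c̃₀` a unit of `O` (★
`isUnit_normSymm_of_criterion`), so `log|c̃₀| = −2·log|a₀| ∈ 4ℤ` by (rE).  §4 **`exists_rational_good_iff_even`: (∃ rational GOOD `a`) ↔ Even(½·log|d₀| + n)** — and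
«`Even(½·log|d₀| + n)`» is «`κ = (−1)^n`» once κ is read on `d₀` (★ `finKappaAt_eq_ite_of_eigenvector`: `κ = 1 ⟺ d₀ ∈ N(L_w^×) ⟺ log|d₀|_w` even), the [T2-d] reading.

* §1 (private `Fin 3` product helpers), `map_symmCriterion_one_eq`, `map_symmCriterion_zero_eq`,
  `log_v_symmCriterion_zero`, `log_v_symmCriterion_one`.
* §2 **`exists_rational_good_of_even`**.  §3 **`even_of_rational_good`**.  §4 **`exists_rational_good_iff_even`**.

## References
* [Rogawski1990] J. D. Rogawski, *Automorphic Representations of Unitary Groups in Three Variables* (1990), §4.9 Lemma 4.9.3 p. 56, Prop. 4.9.1 (b) p. 55.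
* [Jacobowitz1962] R. Jacobowitz, *Hermitian forms over local fields*, Amer. J. Math. 84 (1962), §4, §5, §7 Thm. 7.1.
* [SerreLocalFields1979] J.-P. Serre, *Local Fields*, GTM 67 (1979), Ch. V §2 Prop. 3 (norms at an unramified extension), Ch. I §6 (ramified quadratic).
* [LanglandsShelstad1987] R. P. Langlands, D. Shelstad, *On the definition of transfer factors*, Math. Ann. 278 (1987), §1.3–1.4.
-/

set_option autoImplicit false

open Finset
open scoped WithZero

namespace Literature.NumberTheory.Automorphic.SymmetricEigenframe

open Literature.NumberTheory.Automorphic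

variable {K : Type*} [Field K]

/-! ## §1 The symmetrised criterion scalars of a symmetric eigen-datum -/

/-- `∏_{j ≠ 0} f j = f 1 · f 2` on `Fin 3`. [folklore] -/
private theorem prod_erase_zero_three {M : Type*} [CommMonoid M] (f : Fin 3 → M) : ∏ j ∈ univ.erase (0 : Fin 3), f j = f 1 * f 2 := by
  rw [show univ.erase (0 : Fin 3) = {1, 2} by decide, Finset.prod_pair (by decide)]

/-- `∏_{j ≠ 1} f j = f 0 · f 2` on `Fin 3`. [folklore] -/
private theorem prod_erase_one_three {M : Type*} [CommMonoid M] (f : Fin 3 → M) : ∏ j ∈ univ.erase (1 : Fin 3), f j = f 0 * f 2 := by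
  rw [show univ.erase (1 : Fin 3) = {0, 2} by decide, Finset.prod_pair (by decide)]

/-- `∏_{j ≠ 2} f j = f 0 · f 1` on `Fin 3`. [folklore] -/
private theorem prod_erase_two_three {M : Type*} [CommMonoid M] (f : Fin 3 → M) : ∏ j ∈ univ.erase (2 : Fin 3), f j = f 0 * f 1 := by
  rw [show univ.erase (2 : Fin 3) = {0, 1} by decide, Finset.prod_pair (by decide)]

/-- **`c̃₂ = ι c̃₁`**: the involution `ι` (fixing `γ₀`, `δ`, exchanging `γ₁, γ₂` and `d₁, d₂`) carries the symmetrised criterion scalar at `1` to the one at `2`.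
[cite: Rogawski1990, §4.9 Lemma 4.9.3 p. 56] -/
theorem map_symmCriterion_one_eq (ι : K →+* K) {γ d : Fin 3 → K} {δ : K} (hγ0 : ι (γ 0) = γ 0) (hγ1 : ι (γ 1) = γ 2) (hγ2 : ι (γ 2) = γ 1)
    (hd1 : ι (d 1) = d 2) (hδ : ι δ = δ) :
    ι (d 1 * ∏ j ∈ univ.erase (1 : Fin 3), (γ 1 - γ j) / ((1 + γ 1) * (1 + γ j) * δ)) =
      d 2 * ∏ j ∈ univ.erase (2 : Fin 3), (γ 2 - γ j) / ((1 + γ 2) * (1 + γ j) * δ) := by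
  rw [prod_erase_one_three (fun j => (γ 1 - γ j) / ((1 + γ 1) * (1 + γ j) * δ)), prod_erase_two_three (fun j => (γ 2 - γ j) / ((1 + γ 2) * (1 + γ j) * δ))]
  simp only [map_mul, map_div₀, map_sub, map_add, map_one, hγ0, hγ1, hγ2, hd1, hδ]

/-- **`ι c̃₀ = c̃₀`**: the symmetrised criterion scalar at the rational eigenvalue is `ι`-fixed. [cite: Rogawski1990, §4.9 Lemma 4.9.3 p. 56] -/
theorem map_symmCriterion_zero_eq (ι : K →+* K) {γ d : Fin 3 → K} {δ : K} (hγ0 : ι (γ 0) = γ 0) (hγ1 : ι (γ 1) = γ 2) (hγ2 : ι (γ 2) = γ 1)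
    (hd0 : ι (d 0) = d 0) (hδ : ι δ = δ) :
    ι (d 0 * ∏ j ∈ univ.erase (0 : Fin 3), (γ 0 - γ j) / ((1 + γ 0) * (1 + γ j) * δ)) =
      d 0 * ∏ j ∈ univ.erase (0 : Fin 3), (γ 0 - γ j) / ((1 + γ 0) * (1 + γ j) * δ) := by
  rw [prod_erase_zero_three (fun j => (γ 0 - γ j) / ((1 + γ 0) * (1 + γ j) * δ))]
  simp only [map_mul, map_div₀, map_sub, map_add, map_one, hγ0, hγ1, hγ2, hd0, hδ]
  ring

section Valued

variable [Valued K ℤᵐ⁰]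

/-- **`log|c̃₀| = log|d₀| + log|γ₀ − γ₁| + log|γ₀ − γ₂|`** when `1 + γᵢ` and `δ` are units (`|·| = 1`) and the data are non-zero. [cite: Jacobowitz1962, §4] -/
theorem log_v_symmCriterion_zero {γ d : Fin 3 → K} {δ : K} (hγ1 : ∀ i, Valued.v (1 + γ i) = 1) (hδ : Valued.v δ = 1) (hd0 : d 0 ≠ 0)
    (h01 : γ 0 - γ 1 ≠ 0) (h02 : γ 0 - γ 2 ≠ 0) :
    WithZero.log (Valued.v (d 0 * ∏ j ∈ univ.erase (0 : Fin 3), (γ 0 - γ j) / ((1 + γ 0) * (1 + γ j) * δ))) =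
      WithZero.log (Valued.v (d 0)) + WithZero.log (Valued.v (γ 0 - γ 1)) + WithZero.log (Valued.v (γ 0 - γ 2)) := by
  rw [prod_erase_zero_three (fun j => (γ 0 - γ j) / ((1 + γ 0) * (1 + γ j) * δ))]
  simp only [map_mul, map_div₀, hγ1, hδ, mul_one, div_one]
  rw [WithZero.log_mul ((Valuation.ne_zero_iff _).2 hd0) (mul_ne_zero ((Valuation.ne_zero_iff _).2 h01) ((Valuation.ne_zero_iff _).2 h02)),
    WithZero.log_mul ((Valuation.ne_zero_iff _).2 h01) ((Valuation.ne_zero_iff _).2 h02), add_assoc]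

/-- **`log|c̃₁| = log|d₁| + log|γ₁ − γ₀| + log|γ₁ − γ₂|`** (same hypotheses). [cite: Jacobowitz1962, §4] -/
theorem log_v_symmCriterion_one {γ d : Fin 3 → K} {δ : K} (hγ1 : ∀ i, Valued.v (1 + γ i) = 1) (hδ : Valued.v δ = 1) (hd1 : d 1 ≠ 0)
    (h10 : γ 1 - γ 0 ≠ 0) (h12 : γ 1 - γ 2 ≠ 0) :
    WithZero.log (Valued.v (d 1 * ∏ j ∈ univ.erase (1 : Fin 3), (γ 1 - γ j) / ((1 + γ 1) * (1 + γ j) * δ))) =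
      WithZero.log (Valued.v (d 1)) + WithZero.log (Valued.v (γ 1 - γ 0)) + WithZero.log (Valued.v (γ 1 - γ 2)) := by
  rw [prod_erase_one_three (fun j => (γ 1 - γ j) / ((1 + γ 1) * (1 + γ j) * δ))]
  simp only [map_mul, map_div₀, hγ1, hδ, mul_one, div_one]
  rw [WithZero.log_mul ((Valuation.ne_zero_iff _).2 hd1) (mul_ne_zero ((Valuation.ne_zero_iff _).2 h10) ((Valuation.ne_zero_iff _).2 h12)),
    WithZero.log_mul ((Valuation.ne_zero_iff _).2 h10) ((Valuation.ne_zero_iff _).2 h12), add_assoc]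

/-! ## §2 (⟸) A rational good vector from the parity -/

/-- **(⟸) A RATIONAL GOOD VECTOR EXISTS ON THE PARITY CLASS.**  In the dictionary of the module docstring: if `½·log|d₀| + n` is even then there is `a ∈ K³` with `ι a₀ = a₀`,
`a₂ = ι a₁` and `a` GOOD (★ O8a-∃'s token).  The norm equations: `4 ∣ log|c̃₀|` feeds (nE), `log|c̃₁|` even (by the frame parity `Odd(½·log|d₀| + log|d₁|)`) feeds (nK), and
`a₂ := ι a₁` solves the third equation since `c̃₂ = ι c̃₁`, `σι = ισ`; then ★ `exists_criterion_of_norm_solutions`. [cite: Rogawski1990, §4.9 Lemma 4.9.3 p. 56] [cite: Jacobowitz1962, §5, §7 Thm. 7.1]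
[cite: SerreLocalFields1979, Ch. V §2 Prop. 3] -/
theorem exists_rational_good_of_even (O : Subring K) (σ ι : K →+* K) (hσι : ∀ x, σ (ι x) = ι (σ x))
    (hιv : ∀ x, Valued.v (ι x) = Valued.v x)
    (hnK : ∀ c : K, c ≠ 0 → σ c = c → Even (WithZero.log (Valued.v c)) → ∃ a : K, a * σ a * c = 1)
    (hnE : ∀ c : K, c ≠ 0 → σ c = c → ι c = c → (4 : ℤ) ∣ WithZero.log (Valued.v c) → ∃ a : K, ι a = a ∧ a * σ a * c = 1)
    {γ d : Fin 3 → K} (hγO : ∀ i, γ i ∈ O) (hγ1u : ∀ i, ∃ y ∈ O, y * (1 + γ i) = 1) (hγ1 : ∀ i, Valued.v (1 + γ i) = 1)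
    (hσγ : ∀ i, σ (γ i) = (γ i)⁻¹) (hγne : ∀ i, γ i ≠ 0) (hinj : Function.Injective γ)
    (hιγ0 : ι (γ 0) = γ 0) (hιγ1 : ι (γ 1) = γ 2) (hιγ2 : ι (γ 2) = γ 1)
    (hdσ : ∀ i, σ (d i) = d i) (hdne : ∀ i, d i ≠ 0) (hιd0 : ι (d 0) = d 0) (hιd1 : ι (d 1) = d 2)
    {δ : K} (hδO : δ ∈ O) (hδu : ∃ y ∈ O, y * δ = 1) (hδv : Valued.v δ = 1) (hσδ : σ δ = -δ) (hιδ : ι δ = δ)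
    {n N : ℕ} (h01 : WithZero.log (Valued.v (γ 0 - γ 1)) = -(n : ℤ)) (h12 : WithZero.log (Valued.v (γ 1 - γ 2)) = -((2 * N + 1 : ℕ) : ℤ))
    (hd0 : Even (WithZero.log (Valued.v (d 0)))) (hodd : Odd (WithZero.log (Valued.v (d 0)) / 2 + WithZero.log (Valued.v (d 1))))
    (heven : Even (WithZero.log (Valued.v (d 0)) / 2 + n)) :
    ∃ a : Fin 3 → K, ι (a 0) = a 0 ∧ a 2 = ι (a 1) ∧
      ((fun i => d i * a i * σ (a i) * ∏ j ∈ univ.erase i, (γ i - γ j)) ∈ Submodule.span O (Set.range fun j : Fin 3 => fun i => γ i ^ (j : ℕ)) ∧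
        ∀ i, ∃ y ∈ O, y * (d i * a i * σ (a i) * ∏ j ∈ univ.erase i, (γ i - γ j)) = 1) := by
  -- the symmetrised criterion scalars `c̃ i`
  set c : Fin 3 → K := fun i => d i * ∏ j ∈ univ.erase i, (γ i - γ j) / ((1 + γ i) * (1 + γ j) * δ) with hc
  -- differences of eigenvalues
  have h01ne : γ 0 - γ 1 ≠ 0 := sub_ne_zero.2 fun h => by have := hinj h; exact absurd this (by decide)
  have h02ne : γ 0 - γ 2 ≠ 0 := sub_ne_zero.2 fun h => by have := hinj h; exact absurd this (by decide)
  have h12ne : γ 1 - γ 2 ≠ 0 := sub_ne_zero.2 fun h => by have := hinj h; exact absurd this (by decide)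
  have h10ne : γ 1 - γ 0 ≠ 0 := fun h => h01ne (by rw [← neg_sub, h, neg_zero])
  have h02 : WithZero.log (Valued.v (γ 0 - γ 2)) = -(n : ℤ) := by
    rw [← h01, show γ 0 - γ 2 = ι (γ 0 - γ 1) by rw [map_sub, hιγ0, hιγ1], hιv]
  have h10 : WithZero.log (Valued.v (γ 1 - γ 0)) = -(n : ℤ) := by rw [← neg_sub, Valuation.map_neg, h01]
  -- `σ`- and `ι`-behaviour of `c̃`
  have hcσ : ∀ i, σ (c i) = c i := fun i => by
    simp only [hc, map_mul, hdσ, symmProd_fixed σ hσγ hγne hσδ i]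
  have hcι0 : ι (c 0) = c 0 := map_symmCriterion_zero_eq ι hιγ0 hιγ1 hιγ2 hιd0 hιδ
  have hcι1 : ι (c 1) = c 2 := map_symmCriterion_one_eq ι hιγ0 hιγ1 hιγ2 hιd1 hιδ
  -- `c̃ i ≠ 0` and the exponents
  have hc0log : WithZero.log (Valued.v (c 0)) = WithZero.log (Valued.v (d 0)) - 2 * n := by
    have h := log_v_symmCriterion_zero (d := d) hγ1 hδv (hdne 0) h01ne h02ne
    simp only [hc]
    rw [h, h01, h02]; ring
  have hc1log : WithZero.log (Valued.v (c 1)) = WithZero.log (Valued.v (d 1)) - n - (2 * N + 1 : ℕ) := by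
    have h := log_v_symmCriterion_one (d := d) hγ1 hδv (hdne 1) h10ne h12ne
    simp only [hc]
    rw [h, h10, h12]; ring
  have hunit_ne : ∀ {x : K}, Valued.v x = 1 → x ≠ 0 := fun {x} hx h0 => by rw [h0, map_zero] at hx; exact zero_ne_one hx
  have hcne : ∀ i, c i ≠ 0 := by
    intro i
    simp only [hc]
    refine mul_ne_zero (hdne i) (Finset.prod_ne_zero_iff.2 fun j hj => div_ne_zero (sub_ne_zero.2 fun h => ?_) ?_)
    · exact (Finset.ne_of_mem_erase hj) (hinj h).symm
    · exact mul_ne_zero (mul_ne_zero (hunit_ne (hγ1 i)) (hunit_ne (hγ1 j))) (hunit_ne hδv)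
  -- the two parities
  obtain ⟨k0, hk0⟩ := hd0
  have h4 : (4 : ℤ) ∣ WithZero.log (Valued.v (c 0)) := by
    obtain ⟨m, hm⟩ := heven
    rw [hc0log]
    exact ⟨m - n, by omega⟩
  have heven1 : Even (WithZero.log (Valued.v (c 1))) := by
    have hpar := (even_and_even_iff_of_odd_add (n := (n : ℤ)) (N := (N : ℤ)) hodd).2 heven
    obtain ⟨m, hm⟩ := hpar.2
    rw [hc1log]
    exact ⟨m - n - 2 * N - 1, by push_cast; omega⟩
  -- the norm solutions
  obtain ⟨a0, ha0ι, ha0⟩ := hnE (c 0) (hcne 0) (hcσ 0) hcι0 h4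
  obtain ⟨a1, ha1⟩ := hnK (c 1) (hcne 1) (hcσ 1) heven1
  have ha2 : ι a1 * σ (ι a1) * c 2 = 1 := by
    rw [hσι, ← hcι1, ← map_mul, ← map_mul, ha1, map_one]
  refine ⟨![a0, a1, ι a1], ha0ι, rfl, ?_⟩
  have ha : ∀ i, (![a0, a1, ι a1] : Fin 3 → K) i * σ ((![a0, a1, ι a1] : Fin 3 → K) i) *
      (d i * ∏ j ∈ univ.erase i, (γ i - γ j) / ((1 + γ i) * (1 + γ j) * δ)) = 1 := by
    intro i
    fin_cases i
    · exact ha0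
    · exact ha1
    · exact ha2
  exact exists_criterion_of_norm_solutions O σ hγO hγ1u hδO hδu d _ ha

/-! ## §3 (⟹) The parity from a rational good vector -/

/-- **(⟹) A RATIONAL GOOD VECTOR FORCES THE PARITY**: if `a` is GOOD with `ι a₀ = a₀ ≠ 0` then `a₀σ(a₀)·c̃₀` is a unit of `O` (★ `isUnit_normSymm_of_criterion`), so
`log|c̃₀| = −2·log|a₀| ∈ 4ℤ` ((rE): rational elements have even `log|·|`), i.e. `½·log|d₀| + n` is even. [cite: Rogawski1990, §4.9 Lemma 4.9.3 p. 56] [cite: Jacobowitz1962, §5] -/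
theorem even_of_rational_good (O : Subring K) (σ ι : K →+* K) (hO : ∀ x ∈ O, Valued.v x ≤ 1)
    (hσv : ∀ x, Valued.v (σ x) = Valued.v x) (hrE : ∀ x : K, x ≠ 0 → ι x = x → Even (WithZero.log (Valued.v x)))
    {γ d : Fin 3 → K} (hγO : ∀ i, γ i ∈ O) (hγ1u : ∀ i, ∃ y ∈ O, y * (1 + γ i) = 1) (hγ1 : ∀ i, Valued.v (1 + γ i) = 1)
    (hinj : Function.Injective γ) (hιγ0 : ι (γ 0) = γ 0) (hιγ1 : ι (γ 1) = γ 2) (hιv : ∀ x, Valued.v (ι x) = Valued.v x)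
    (hdne : ∀ i, d i ≠ 0)
    {δ : K} (hδO : δ ∈ O) (hδu : ∃ y ∈ O, y * δ = 1) (hδv : Valued.v δ = 1)
    {n : ℕ} (h01 : WithZero.log (Valued.v (γ 0 - γ 1)) = -(n : ℤ)) (hd0 : Even (WithZero.log (Valued.v (d 0))))
    {a : Fin 3 → K} (ha0 : ι (a 0) = a 0)
    (hgood : ((fun i => d i * a i * σ (a i) * ∏ j ∈ univ.erase i, (γ i - γ j)) ∈ Submodule.span O (Set.range fun j : Fin 3 => fun i => γ i ^ (j : ℕ)) ∧
        ∀ i, ∃ y ∈ O, y * (d i * a i * σ (a i) * ∏ j ∈ univ.erase i, (γ i - γ j)) = 1)) :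
    Even (WithZero.log (Valued.v (d 0)) / 2 + n) := by
  have h01ne : γ 0 - γ 1 ≠ 0 := sub_ne_zero.2 fun h => by have := hinj h; exact absurd this (by decide)
  have h02ne : γ 0 - γ 2 ≠ 0 := sub_ne_zero.2 fun h => by have := hinj h; exact absurd this (by decide)
  have h02 : WithZero.log (Valued.v (γ 0 - γ 2)) = -(n : ℤ) := by
    rw [← h01, show γ 0 - γ 2 = ι (γ 0 - γ 1) by rw [map_sub, hιγ0, hιγ1], hιv]
  -- the criterion vector lies in `O` componentwise (from the span membership)
  have hTO : ∀ i, d i * a i * σ (a i) * ∏ j ∈ univ.erase i, (γ i - γ j) ∈ O := by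
    intro i
    have hmem := hgood.1
    refine Submodule.span_induction (p := fun x _ => x i ∈ O) ?_ ?_ ?_ ?_ hmem
    · rintro x ⟨j, rfl⟩; exact O.pow_mem (hγO i) _
    · exact O.zero_mem
    · intro x y _ _ hx hy; exact O.add_mem hx hy
    · intro r x _ hx; exact O.mul_mem r.2 hx
  obtain ⟨hmem0, y, hyO, hy⟩ := isUnit_normSymm_of_criterion O σ hγO hγ1u hδO hδu d a hTO hgood.2 0
  -- valuations: `x ∈ O`, `y ∈ O`, `y x = 1` ⇒ `|x| = 1`
  set x : K := a 0 * σ (a 0) * (d 0 * ∏ j ∈ univ.erase (0 : Fin 3), (γ 0 - γ j) / ((1 + γ 0) * (1 + γ j) * δ)) with hx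
  have hvx : Valued.v x = 1 := by
    apply le_antisymm (hO x hmem0)
    have h1 : Valued.v y * Valued.v x = 1 := by rw [← map_mul, hy, map_one]
    by_contra hlt
    rw [not_le] at hlt
    have : Valued.v y * Valued.v x < 1 := by
      calc Valued.v y * Valued.v x ≤ 1 * Valued.v x := by gcongr; exact hO y hyO
        _ < 1 := by rw [one_mul]; exact hlt
    rw [h1] at this
    exact lt_irrefl _ this
  have ha0ne : a 0 ≠ 0 := fun h0 => by rw [hx, h0, zero_mul, zero_mul, map_zero] at hvx; exact zero_ne_one hvx
  -- `log|c̃₀| = log|d₀| − 2n` and `log|a₀ σ a₀ c̃₀| = 0`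
  have hc0log := log_v_symmCriterion_zero (d := d) hγ1 hδv (hdne 0) h01ne h02ne
  rw [h01, h02] at hc0log
  have hc0ne : d 0 * ∏ j ∈ univ.erase (0 : Fin 3), (γ 0 - γ j) / ((1 + γ 0) * (1 + γ j) * δ) ≠ 0 := fun h0 => by
    rw [hx, h0, mul_zero, map_zero] at hvx; exact zero_ne_one hvx
  have hlog := congrArg WithZero.log hvx
  rw [hx, map_mul, map_mul, hσv, WithZero.log_one,
    WithZero.log_mul (mul_ne_zero ((Valuation.ne_zero_iff _).2 ha0ne) ((Valuation.ne_zero_iff _).2 ha0ne)) ((Valuation.ne_zero_iff _).2 hc0ne),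
    WithZero.log_mul ((Valuation.ne_zero_iff _).2 ha0ne) ((Valuation.ne_zero_iff _).2 ha0ne), hc0log] at hlog
  obtain ⟨k, hk⟩ := hrE (a 0) ha0ne ha0
  obtain ⟨k0, hk0⟩ := hd0
  exact ⟨n - k, by omega⟩

/-! ## §4 The equivalence -/

/-- **[T2-b] CORE — «THE GOOD CLASS IS THE ONE WITH `κ = (−1)^n`»**: for a symmetric type-(2) eigen-datum `(γ, d, δ)` over the ramified eigen-field `K` with its two involutions
`σ` (CM, unramified) and `ι` (rationality, ramified) and the norm dictionaries (nK), (nE), (rE), a RATIONAL GOOD vector exists **iff** `½·log|d₀| + n` is even — i.e. iff the sign `κ`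
read on the rational Gram value `d₀` (★ `finKappaAt_eq_ite_of_eigenvector`) equals `(−1)^n`.  Consequently the free-row count of ★ [T2-a] is `[C : R^×]` on that class and `0` on the
other, and `n₂(δ₊) − n₂(δ₋) = (−1)^n·[C : R^×]`. [cite: Rogawski1990, §4.9 Lemma 4.9.3 p. 56, Prop. 4.9.1 (b) p. 55] [cite: Jacobowitz1962, §5, §7 Thm. 7.1] [cite: LanglandsShelstad1987, §1.3–1.4] -/
theorem exists_rational_good_iff_even (O : Subring K) (hO : ∀ x ∈ O, Valued.v x ≤ 1) (σ ι : K →+* K) (hσι : ∀ x, σ (ι x) = ι (σ x))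
    (hσv : ∀ x, Valued.v (σ x) = Valued.v x) (hιv : ∀ x, Valued.v (ι x) = Valued.v x)
    (hnK : ∀ c : K, c ≠ 0 → σ c = c → Even (WithZero.log (Valued.v c)) → ∃ a : K, a * σ a * c = 1)
    (hnE : ∀ c : K, c ≠ 0 → σ c = c → ι c = c → (4 : ℤ) ∣ WithZero.log (Valued.v c) → ∃ a : K, ι a = a ∧ a * σ a * c = 1)
    (hrE : ∀ x : K, x ≠ 0 → ι x = x → Even (WithZero.log (Valued.v x)))
    {γ d : Fin 3 → K} (hγO : ∀ i, γ i ∈ O) (hγ1u : ∀ i, ∃ y ∈ O, y * (1 + γ i) = 1) (hγ1 : ∀ i, Valued.v (1 + γ i) = 1)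
    (hσγ : ∀ i, σ (γ i) = (γ i)⁻¹) (hγne : ∀ i, γ i ≠ 0) (hinj : Function.Injective γ)
    (hιγ0 : ι (γ 0) = γ 0) (hιγ1 : ι (γ 1) = γ 2) (hιγ2 : ι (γ 2) = γ 1)
    (hdσ : ∀ i, σ (d i) = d i) (hdne : ∀ i, d i ≠ 0) (hιd0 : ι (d 0) = d 0) (hιd1 : ι (d 1) = d 2)
    {δ : K} (hδO : δ ∈ O) (hδu : ∃ y ∈ O, y * δ = 1) (hδv : Valued.v δ = 1) (hσδ : σ δ = -δ) (hιδ : ι δ = δ)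
    {n N : ℕ} (h01 : WithZero.log (Valued.v (γ 0 - γ 1)) = -(n : ℤ)) (h12 : WithZero.log (Valued.v (γ 1 - γ 2)) = -((2 * N + 1 : ℕ) : ℤ))
    (hd0 : Even (WithZero.log (Valued.v (d 0)))) (hodd : Odd (WithZero.log (Valued.v (d 0)) / 2 + WithZero.log (Valued.v (d 1)))) :
    (∃ a : Fin 3 → K, ι (a 0) = a 0 ∧ a 2 = ι (a 1) ∧
      ((fun i => d i * a i * σ (a i) * ∏ j ∈ univ.erase i, (γ i - γ j)) ∈ Submodule.span O (Set.range fun j : Fin 3 => fun i => γ i ^ (j : ℕ)) ∧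
        ∀ i, ∃ y ∈ O, y * (d i * a i * σ (a i) * ∏ j ∈ univ.erase i, (γ i - γ j)) = 1)) ↔
      Even (WithZero.log (Valued.v (d 0)) / 2 + n) := by
  constructor
  · rintro ⟨a, ha0, -, hgood⟩
    exact even_of_rational_good O σ ι hO hσv hrE hγO hγ1u hγ1 hinj hιγ0 hιγ1 hιv hdne hδO hδu hδv h01 hd0 ha0 hgood
  · exact exists_rational_good_of_even O σ ι hσι hιv hnK hnE hγO hγ1u hγ1 hσγ hγne hinj hιγ0 hιγ1 hιγ2 hdσ hdne hιd0 hιd1 hδO hδu hδv hσδ hιδ h01 h12 hd0 hodd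

end Valued

end Literature.NumberTheory.Automorphic.SymmetricEigenframe
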